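import Mathlib
import Literature.AlgebraicGeometry.Resolution.WeightedResolutionDatum
import Summits.ResolutionOfSingularities.ResolutionOfSingularities.Theorems.WeightedInvariantDatumToEmbeddedCentreHomogeneousCoaction
import HarnessLib

/-!
# The centre of a weighted resolution datum is homogeneous on graded charts

Topic: `Summits/ResolutionOfSingularities/ResolutionOfSingularities/Theorems`. Stub
`stub_centre_isHomogeneous` of the line `Sketch` of the crux
`Theses.WeightedInvariant.DatumToEmbedded` (statement `stmt-ResolutionOfSingularities-0572`).

Let `D` be a weighted resolution datum (`Literature…WeightedResolutionDatum`), `f : Y → Spec k`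
smooth separated quasi-compact over a perfect field, `I` an ideal sheaf on `Y` with `inv` not
everywhere minimal, and `W ⊆ Y` an affine chart carrying a `ℤʲ`-grading `𝒜` of `A = Γ(Y, W)` with
the constants in degree `0` and `I(W)` homogeneous (the graded encoding of a `𝔾ₘʲ`-stable chart).
Then every piece of the centre `D.centre f I` has homogeneous ideal of sections over `W`
(`stub_centre_isHomogeneous`; Włodarczyk, arXiv:2203.03090, Thm. 1.1.4 (6): functoriality for
group actions). Proof: with `L = A[ℤʲ]` (coordinate ring of the torus chart `T = 𝔾ₘʲ × W`), the
grading is the coaction `ρ : A → L`, `a ↦ Σ a_χ [χ]`, and `ι₀ : A → L` is the projection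
(companion file `…CentreHomogeneousCoaction.lean`: `exists_coaction`, `smooth_coaction`,
`map_coaction_eq_of_isHomogeneous`, `isHomogeneous_of_map_coaction_le`);
`act = Spec ρ ≫ (W ⊆ Y)` and `pr = Spec ι₀ ≫ (W ⊆ Y)` are smooth, agree on `Spec k` (constants
have degree `0`) and pull `I` back to the same ideal sheaf (`I(W)` homogeneous ⇒
`ρ(I(W)) L = I(W) L`). Gluing each with `𝟙_Y` gives smooth SURJECTIVE `k`-morphisms
`T ⊔ Y → Y` (`smooth_coprodDesc`, `surjective_coprodDesc`, `quasiCompact_coprodDesc_comp`,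
`isSeparated_coprodDesc_comp`) to which axiom `(i)` of the datum (`centre_comap`) applies;
comparing the two pull-backs of a piece `Jₙ` of the centre on `T` gives `ρ(Jₙ(W)) L = Jₙ(W) L`,
which forces `Jₙ(W)` to be homogeneous. The scheme-theoretic plumbing: ideal sheaves are compared
on an open cover (`idealSheaf_ext_of_openCover`), and the top ideal of a pull-back to an affine
scheme is the extended ideal (`comap_ideal_top`, `comap_SpecMap_fromSpec_ideal_top`).

Only Mathlib, the datum file and the companion algebra file are used; no definitions.
-/

-- the summit namespace repeats `ResolutionOfSingularities` by design (mandated namespace)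
set_option linter.dupNamespace false

namespace Summit.ResolutionOfSingularities.ResolutionOfSingularities.Theorems.DatumToEmbedded.CentreHomogeneous

open AddMonoidAlgebra

/-! ## Pull-backs of ideal sheaves -/

section IdealSheaf

open CategoryTheory CategoryTheory.Limits AlgebraicGeometry TopologicalSpace Opposite

universe u

/-- Ideal sheaves that agree after pull-back to the members of an open cover are equal.
[folklore] -/
theorem idealSheaf_ext_of_openCover {X : Scheme.{u}} (𝒰 : X.OpenCover)
    {K K' : X.IdealSheafData} (h : ∀ i, K.comap (𝒰.f i) = K'.comap (𝒰.f i)) : K = K' := by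
  refine Scheme.IdealSheafData.ext_of_iSup_eq_top (ι := Σ i, (𝒰.X i).affineOpens)
    (fun p => ⟨𝒰.f p.1 ''ᵁ (p.2 : (𝒰.X p.1).Opens), p.2.2.image_of_isOpenImmersion _⟩) ?_ ?_
  · rw [eq_top_iff]
    rintro x -
    obtain ⟨i, y, rfl⟩ := 𝒰.exists_eq x
    obtain ⟨V, hV, hyV, -⟩ := exists_isAffineOpen_mem_and_subset (X := 𝒰.X i) (x := y)
      (U := ⊤) trivial
    exact Opens.mem_iSup.mpr ⟨⟨i, ⟨V, hV⟩⟩, ⟨y, hyV, rfl⟩⟩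
  · rintro ⟨i, V⟩
    have := congrArg (fun K : (𝒰.X i).IdealSheafData => K.ideal V) (h i)
    simp only [Scheme.IdealSheafData.ideal_comap_of_isOpenImmersion] at this
    exact Ideal.comap_injective_of_surjective _
      (ConcreteCategory.bijective_of_isIso ((𝒰.f i).appIso V).inv).2 this

/-- **The pull-back of an ideal sheaf along a morphism of affine schemes is the extended ideal**
(on global sections). [folklore] -/
theorem comap_ideal_top {T S : Scheme.{u}} [IsAffine T] [IsAffine S] (J : S.IdealSheafData)
    (h : T ⟶ S) : (J.comap h).ideal ⟨⊤, isAffineOpen_top T⟩ =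
      (J.ideal ⟨⊤, isAffineOpen_top S⟩).map h.appTop.hom := by
  have key : ∀ K : T.IdealSheafData, J.comap h ≤ K ↔
      (J.ideal ⟨⊤, isAffineOpen_top S⟩).map h.appTop.hom ≤ K.ideal ⟨⊤, isAffineOpen_top T⟩ := by
    intro K
    rw [← Scheme.IdealSheafData.le_map_iff_comap_le, Ideal.map_le_iff_le_comap]
    constructor
    · intro hle
      have := hle ⟨⊤, isAffineOpen_top S⟩
      rwa [Scheme.IdealSheafData.ideal_map K h ⟨⊤, isAffineOpen_top S⟩ (isAffineOpen_top T)]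
        at this
    · intro hle
      refine Scheme.IdealSheafData.le_of_isAffine ?_
      rw [Scheme.IdealSheafData.ideal_map K h ⟨⊤, isAffineOpen_top S⟩ (isAffineOpen_top T)]
      exact hle
  refine le_antisymm ?_ ((key _).mp le_rfl)
  refine ((key (Scheme.IdealSheafData.ofIdealTop
    ((J.ideal ⟨⊤, isAffineOpen_top S⟩).map h.appTop.hom))).mpr (by simp)
      ⟨⊤, isAffineOpen_top T⟩).trans ?_
  simp

/-- For an affine open `W ⊆ Y`, the structure map `Spec Γ(Y, W) → Y` induces the canonical
isomorphism `Γ(Y, W) ≅ Γ(Spec Γ(Y, W), ⊤)` on sections over `W`. [folklore] -/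
theorem fromSpec_appLE_top {Y : Scheme.{u}} (W : Y.affineOpens) :
    W.2.fromSpec.appLE W ⊤ W.2.fromSpec_preimage_self.ge = (Scheme.ΓSpecIso Γ(Y, W)).inv := by
  rw [Scheme.Hom.appLE, IsAffineOpen.fromSpec_app_self, Category.assoc, ← Functor.map_comp,
    ← op_comp, Subsingleton.elim (homOfLE _ ≫ eqToHom _) (𝟙 _)]
  simp

/-- Contracting an ideal along the inverse of a ring isomorphism is extending it along the
isomorphism. [folklore] -/
theorem ideal_comap_iso_inv {R S : CommRingCat.{u}} (e : R ≅ S) (J : Ideal R) :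
    J.comap e.inv.hom = J.map e.hom.hom := by
  refine le_antisymm (fun x hx => ?_) ?_
  · rw [show x = e.hom.hom (e.inv.hom x) by
      rw [← CommRingCat.comp_apply, Iso.inv_hom_id, CommRingCat.id_apply]]
    exact Ideal.mem_map_of_mem _ hx
  · rw [Ideal.map_le_iff_le_comap]
    intro x hx
    rw [Ideal.mem_comap, Ideal.mem_comap, ← CommRingCat.comp_apply, Iso.hom_inv_id,
      CommRingCat.id_apply]
    exact hx

/-- Extending ideals along a ring isomorphism is injective. [folklore] -/
theorem ideal_map_iso_inv_injective {R S : CommRingCat.{u}} (e : R ≅ S) :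
    Function.Injective (Ideal.map e.inv.hom) := fun J₁ J₂ h => by
  simpa [Ideal.map_map, ← CommRingCat.hom_comp] using congrArg (Ideal.map e.hom.hom) h

/-- The pull-back of an ideal sheaf `I` along `Spec Γ(Y, W) → Y` (`W` an affine open) has global
sections `I(W)`. [folklore] -/
theorem comap_fromSpec_ideal_top {Y : Scheme.{u}} (I : Y.IdealSheafData) (W : Y.affineOpens) :
    (I.comap W.2.fromSpec).ideal ⟨⊤, isAffineOpen_top _⟩ =
      (I.ideal W).map (Scheme.ΓSpecIso Γ(Y, W)).inv.hom := by
  have hW : W.2.fromSpec ''ᵁ ⊤ = W := by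
    rw [Scheme.Hom.image_top_eq_opensRange, IsAffineOpen.opensRange_fromSpec]
  rw [Scheme.IdealSheafData.ideal_comap_of_isOpenImmersion,
    ← I.map_ideal' (U := ⟨W.2.fromSpec ''ᵁ ⊤, _⟩) (V := W) (eqToHom hW).op, ideal_comap_iso_inv,
    Ideal.map_map, ← CommRingCat.hom_comp, Scheme.Hom.appIso_hom', Scheme.Hom.map_appLE]
  congr 2
  exact fromSpec_appLE_top W

/-- **Pull-back to a torus chart.** For `φ : Γ(Y, W) → R`, the pull-back of `I` along
`Spec R → Spec Γ(Y, W) → Y` has global sections the extended ideal `φ(I(W)) · R`. [folklore] -/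
theorem comap_SpecMap_fromSpec_ideal_top {Y : Scheme.{u}} (I : Y.IdealSheafData)
    (W : Y.affineOpens) {R : CommRingCat.{u}} (φ : Γ(Y, W) ⟶ R) :
    (I.comap (Spec.map φ ≫ W.2.fromSpec)).ideal ⟨⊤, isAffineOpen_top _⟩ =
      ((I.ideal W).map φ.hom).map (Scheme.ΓSpecIso R).inv.hom := by
  rw [Scheme.IdealSheafData.comap_comp, comap_ideal_top, comap_fromSpec_ideal_top, Ideal.map_map,
    Ideal.map_map, ← CommRingCat.hom_comp, ← CommRingCat.hom_comp, Scheme.ΓSpecIso_inv_naturality]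

end IdealSheaf

/-! ## Gluing a chart map with the identity -/

section Coprod

open CategoryTheory CategoryTheory.Limits AlgebraicGeometry

universe u

variable {T Y S : Scheme.{u}} (a : T ⟶ Y) (f : Y ⟶ S)

/-- `a ⊔ 𝟙 : T ⊔ Y → Y` is smooth when `a` is. [folklore] -/
theorem smooth_coprodDesc [Smooth a] : Smooth (coprod.desc a (𝟙 Y)) := by
  refine IsZariskiLocalAtSource.of_openCover (P := @Smooth) (coprodOpenCover.{u, 0} T Y) ?_
  rintro (⟨⟨⟩⟩ | ⟨⟨⟩⟩)
  · change Smooth (coprod.inl ≫ coprod.desc a (𝟙 Y))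
    rw [coprod.inl_desc]
    infer_instance
  · change Smooth (coprod.inr ≫ coprod.desc a (𝟙 Y))
    rw [coprod.inr_desc]
    infer_instance

/-- `a ⊔ 𝟙 : T ⊔ Y → Y` is surjective. [folklore] -/
theorem surjective_coprodDesc : Surjective (coprod.desc a (𝟙 Y)) := by
  have : Surjective ((coprod.inr : Y ⟶ T ⨿ Y) ≫ coprod.desc a (𝟙 Y)) := by
    rw [coprod.inr_desc]; infer_instance
  exact Surjective.of_comp (coprod.inr : Y ⟶ T ⨿ Y) _

/-- `(a ⊔ 𝟙) ≫ f = ((a ≫ f) ⊔ f) ≫ codiagonal`. [folklore] -/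
theorem coprodDesc_comp : coprod.desc a (𝟙 Y) ≫ f =
    coprod.map (a ≫ f) f ≫ coprod.desc (𝟙 S) (𝟙 S) := by
  apply coprod.hom_ext <;> simp

/-- `(a ⊔ 𝟙) ≫ f` is quasi-compact when `a ≫ f` and `f` are. [folklore] -/
theorem quasiCompact_coprodDesc_comp [QuasiCompact (a ≫ f)] [QuasiCompact f] :
    QuasiCompact (coprod.desc a (𝟙 Y) ≫ f) := by
  rw [coprodDesc_comp]
  haveI : QuasiCompact (coprod.map (a ≫ f) f) :=
    IsZariskiLocalAtTarget.coprodMap _ _ inferInstance inferInstance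
  infer_instance

/-- `(a ⊔ 𝟙) ≫ f` is separated when `a ≫ f` and `f` are. [folklore] -/
theorem isSeparated_coprodDesc_comp [IsSeparated (a ≫ f)] [IsSeparated f] :
    IsSeparated (coprod.desc a (𝟙 Y) ≫ f) := by
  rw [coprodDesc_comp]
  haveI : IsSeparated (coprod.map (a ≫ f) f) :=
    IsZariskiLocalAtTarget.coprodMap _ _ inferInstance inferInstance
  haveI : IsSeparated (coprod.desc (𝟙 S) (𝟙 S)) := IsSeparated.of_isAffineHom _
  infer_instance

end Coprod

/-! ## The stub -/

section Main

open CategoryTheory CategoryTheory.Limits AlgebraicGeometry Literature.AlgebraicGeometry.Resolution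

/-- STUB `stub_centre_isHomogeneous` of the line `Sketch` of the crux `DatumToEmbedded`
(stmt-ResolutionOfSingularities-0572): **on a graded ambient chart the datum's centre is
homogeneous.** For a `𝔾ₘʲ`-stable affine chart `W ⊆ Y` — a `ℤʲ`-grading `𝒜` of `Γ(Y, W)` with the
constants in degree `0` for which `I(W)` is homogeneous — every piece `(D.centre f I).piece n` has
homogeneous ideal of sections over `W`: axiom `(i)` for the centre (`centre_comap`) applied to the
two smooth surjective `k`-morphisms `act ⊔ 𝟙_Y, pr ⊔ 𝟙_Y : (Spec Γ(Y, W)[ℤʲ]) ⊔ Y ⟶ Y`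
(coaction / inclusion on the torus chart), which have the same composite to `Spec k` and pull
`I` back to the same ideal sheaf because `I(W)` is homogeneous; comparing the two pull-backs of
the piece on the torus chart gives homogeneity (Włodarczyk 2022, Thm. 1.1.4 (6): functoriality
for group actions). [folklore] -/
theorem stub_centre_isHomogeneous :
    ∀ {p : ℕ} (D : WeightedResolutionDatum p) {k : Type} [Field k] [CharP k p] [PerfectField k]
      {Y : Scheme.{0}} (f : Y ⟶ Spec (.of k)) [Smooth f] [IsSeparated f] [QuasiCompact f]
      (I : Y.IdealSheafData), (∃ y : Y, ¬ IsBot (D.inv f I y)) →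
      ∀ {j : ℕ} (W : Y.affineOpens) (𝒜 : (Fin j → ℤ) → AddSubgroup Γ(Y, W)) [GradedRing 𝒜],
      (∀ c : Γ(Spec (.of k), ⊤), f.appLE ⊤ W le_top c ∈ 𝒜 0) →
      (I.ideal W).IsHomogeneous 𝒜 →
      ∀ n : ℕ, (((D.centre f I).piece n).ideal W).IsHomogeneous 𝒜 := by
  intro p D k _ _ _ Y f _ _ _ I hguard j W 𝒜 _ h0 hI n
  obtain ⟨ρ, hρ⟩ := exists_coaction 𝒜
  -- the torus chart `T = 𝔾ₘʲ × W` with its action and projection maps to `Y`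
  let L : Type := (Γ(Y, W) : Type)[Fin j → ℤ]
  let T : Scheme.{0} := Spec (.of L)
  let φa : Γ(Y, W) ⟶ CommRingCat.of L := CommRingCat.ofHom ρ
  let φp : Γ(Y, W) ⟶ CommRingCat.of L := CommRingCat.ofHom singleZeroRingHom
  let act : T ⟶ Y := Spec.map φa ≫ W.2.fromSpec
  let pr : T ⟶ Y := Spec.map φp ≫ W.2.fromSpec
  haveI : Smooth (Spec.map φa) :=
    (HasRingHomProperty.Spec_iff (P := @Smooth)).mpr (smooth_coaction 𝒜 ρ hρ)
  haveI : Smooth (Spec.map φp) :=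
    (HasRingHomProperty.Spec_iff (P := @Smooth)).mpr (smooth_singleZeroRingHom _ j)
  haveI : Smooth act := inferInstance
  haveI : Smooth pr := inferInstance
  -- the two maps agree on `Spec k` (constants have degree `0`) …
  have hcompT : act ≫ f = pr ≫ f := by
    have key : f.appLE ⊤ W le_top ≫ φa = f.appLE ⊤ W le_top ≫ φp := by
      apply CommRingCat.hom_ext
      refine RingHom.ext fun c => ?_
      simp only [φa, φp, CommRingCat.hom_comp, CommRingCat.hom_ofHom, RingHom.comp_apply]
      exact hρ 0 _ (h0 c)
    simp only [act, pr, Category.assoc]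
    rw [← IsAffineOpen.SpecMap_appLE_fromSpec f (isAffineOpen_top _) W.2 le_top,
      ← Spec.map_comp_assoc, ← Spec.map_comp_assoc, key]
  -- … and pull `I` back to the same ideal sheaf (`I(W)` is homogeneous)
  have hcomapT : I.comap act = I.comap pr := by
    refine Scheme.IdealSheafData.ext_of_isAffine ?_
    simp only [act, pr]
    rw [comap_SpecMap_fromSpec_ideal_top, comap_SpecMap_fromSpec_ideal_top]
    simp only [φa, φp, CommRingCat.hom_ofHom]
    rw [map_coaction_eq_of_isHomogeneous 𝒜 ρ hρ hI]
  -- glue each with the identity of `Y`: smooth surjective `k`-morphisms `T ⊔ Y ⟶ Y`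
  obtain ⟨g, hgl, hgr, _, _, _, _⟩ : ∃ g : T ⨿ Y ⟶ Y, coprod.inl ≫ g = act ∧
      coprod.inr ≫ g = 𝟙 Y ∧ Smooth g ∧ Surjective g ∧ QuasiCompact (g ≫ f) ∧
      IsSeparated (g ≫ f) :=
    ⟨coprod.desc act (𝟙 Y), coprod.inl_desc _ _, coprod.inr_desc _ _, smooth_coprodDesc act,
      surjective_coprodDesc act, quasiCompact_coprodDesc_comp act f,
      isSeparated_coprodDesc_comp act f⟩
  obtain ⟨g', hgl', hgr', _, _, _, _⟩ : ∃ g : T ⨿ Y ⟶ Y, coprod.inl ≫ g = pr ∧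
      coprod.inr ≫ g = 𝟙 Y ∧ Smooth g ∧ Surjective g ∧ QuasiCompact (g ≫ f) ∧
      IsSeparated (g ≫ f) :=
    ⟨coprod.desc pr (𝟙 Y), coprod.inl_desc _ _, coprod.inr_desc _ _, smooth_coprodDesc pr,
      surjective_coprodDesc pr, quasiCompact_coprodDesc_comp pr f,
      isSeparated_coprodDesc_comp pr f⟩
  have hcomp : g ≫ f = g' ≫ f := by
    apply coprod.hom_ext
    · rw [reassoc_of% hgl, reassoc_of% hgl', hcompT]
    · rw [reassoc_of% hgr, reassoc_of% hgr']
  have hcomap : I.comap g = I.comap g' := by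
    refine idealSheaf_ext_of_openCover (coprodOpenCover.{0, 0} T Y) fun i => ?_
    rcases i with ⟨⟨⟩⟩ | ⟨⟨⟩⟩
    · change (I.comap g).comap coprod.inl = (I.comap g').comap coprod.inl
      rw [← Scheme.IdealSheafData.comap_comp, ← Scheme.IdealSheafData.comap_comp, hgl, hgl']
      exact hcomapT
    · change (I.comap g).comap coprod.inr = (I.comap g').comap coprod.inr
      rw [← Scheme.IdealSheafData.comap_comp, ← Scheme.IdealSheafData.comap_comp, hgr, hgr']
  -- functoriality of the centre for `g` and `g'`, read off on the torus chart
  have hc := D.centre_comap f (g ≫ f) g rfl I hguard n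
  have hc' := D.centre_comap f (g' ≫ f) g' rfl I hguard n
  rw [← hcomp, ← hcomap, hc] at hc'
  have hC : ((D.centre f I).piece n).comap act = ((D.centre f I).piece n).comap pr := by
    rw [← hgl, ← hgl', Scheme.IdealSheafData.comap_comp, Scheme.IdealSheafData.comap_comp, hc']
  have hC' := congrArg (fun K : T.IdealSheafData => K.ideal ⟨⊤, isAffineOpen_top T⟩) hC
  simp only [act, pr] at hC'
  rw [comap_SpecMap_fromSpec_ideal_top, comap_SpecMap_fromSpec_ideal_top] at hC'
  simp only [φa, φp, CommRingCat.hom_ofHom] at hC'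
  exact isHomogeneous_of_map_coaction_le 𝒜 ρ hρ (ideal_map_iso_inv_injective _ hC').le

end Main

end Summit.ResolutionOfSingularities.ResolutionOfSingularities.Theorems.DatumToEmbedded.CentreHomogeneous
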